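import Mathlib
import Summits.Ventures.HodgeRepro2.T6N1Hyp
import Summits.Ventures.HodgeRepro2.T6A1Hodge
import Summits.Ventures.HodgeRepro2.T5Assembly

/-!
# T6N1Main — sub-step N1 in kernel: `N1_main` (TARGET-T6 §9.3; owner t6-p1)

TIER5 Theorem ID (route/T5-ID-p2.md v10.1) over the N1 datum: the quadruple period `I_{τ₁}(D_c, c)` of
the M2 datum (`NDatum.I`) equals `± c_K · ⟨F_A, F_B⟩_{L²([G])}` (`I_eq`), hence is non-zero when the
Petersson pairing is (`N1_main`, the field statement `N1` of `T5Assembly.AssemblyCore`, obtained through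
`T5Assembly.N1_of_const` with `κ c = ± c_K ≠ 0`). Kernel content: ID-1 (the sorting of the four
pull-backs into two `(1,0)`- and two `(0,1)`-classes, from the balanced face and the displayed
morphism-of-Hodge-structures property of `f^*`), the anticommutation bookkeeping of the reordering
`v_0 v_1 v_2 v_3 = ± v_a v_b · v_c v_d`, the conjugation `v_c v_d = \overline{\overline{v_c} \overline{v_d}}`,
and the assembly of the three displayed identifications. §8(d): uses an L-value-free non-vanishing device: NO.
-/

namespace Summit.Ventures.HodgeRepro2.T6.N1Main

open scoped InnerProductSpace
open A1Hodge

section reorder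

variable {R : Type*} [Ring R]

/-- Four pairwise anticommuting elements: the product in the order `0 1 2 3` is, up to sign, the product
of the two chosen positions `a < b` times the product of the two remaining positions `c < d`. -/
theorem prod_eq_pair (x : Fin 4 → R) (hswap : ∀ i j, x i * x j = -(x j * x i)) (a b : Fin 4)
    (hab : a < b) :
    ∃ c d : Fin 4, c < d ∧ c ≠ a ∧ c ≠ b ∧ d ≠ a ∧ d ≠ b ∧
      (x 0 * x 1 * x 2 * x 3 = x a * x b * (x c * x d) ∨
        x 0 * x 1 * x 2 * x 3 = -(x a * x b * (x c * x d))) := by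
  have c02 : x 0 * x 1 * x 2 * x 3 = -(x 0 * x 2 * (x 1 * x 3)) := by
    rw [mul_assoc (x 0) (x 1), hswap 1 2, mul_neg, neg_mul, ← mul_assoc, mul_assoc (x 0 * x 2)]
  fin_cases a <;> fin_cases b
  · exact absurd hab (by decide)
  · exact ⟨2, 3, by decide, by decide, by decide, by decide, by decide, Or.inl (mul_assoc _ _ _)⟩
  · exact ⟨1, 3, by decide, by decide, by decide, by decide, by decide, Or.inr c02⟩
  · refine ⟨1, 2, by decide, by decide, by decide, by decide, by decide, Or.inl ?_⟩
    show x 0 * x 1 * x 2 * x 3 = x 0 * x 3 * (x 1 * x 2)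
    rw [mul_assoc (x 0) (x 1), mul_assoc (x 0), even_comm x hswap 1 2 3, ← mul_assoc]
  · exact absurd hab (by decide)
  · exact absurd hab (by decide)
  · refine ⟨0, 3, by decide, by decide, by decide, by decide, by decide, Or.inl ?_⟩
    show x 0 * x 1 * x 2 * x 3 = x 1 * x 2 * (x 0 * x 3)
    rw [mul_assoc (x 0) (x 1), ← even_comm x hswap 1 2 0, mul_assoc (x 1 * x 2)]
  · refine ⟨0, 2, by decide, by decide, by decide, by decide, by decide, Or.inr ?_⟩
    show x 0 * x 1 * x 2 * x 3 = -(x 1 * x 3 * (x 0 * x 2))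
    rw [c02, pair_comm x hswap 0 2 1 3]
  · exact absurd hab (by decide)
  · exact absurd hab (by decide)
  · exact absurd hab (by decide)
  · refine ⟨0, 1, by decide, by decide, by decide, by decide, by decide, Or.inl ?_⟩
    show x 0 * x 1 * x 2 * x 3 = x 2 * x 3 * (x 0 * x 1)
    rw [mul_assoc (x 0 * x 1), pair_comm x hswap 0 1 2 3]
  · exact absurd hab (by decide)
  · exact absurd hab (by decide)
  · exact absurd hab (by decide)
  · exact absurd hab (by decide)

end reorder

variable {K : Type*} [Field K] [NumberField K]

/-- `ℓ_{i,σ} ⊂ H^{1,0}(B)` for `σ ∈ T_i` (the interface's `h10`). -/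
theorem eigenLine_le_h10 (F : FaceSetting K) {i : Fin 4} {σ : K →+* ℂ} (h : σ ∈ F.T i) :
    eigenLine K i σ ≤ h10 F :=
  le_iSup_of_le i (le_iSup_of_le σ (le_iSup (fun _ : σ ∈ F.T i => eigenLine K i σ) h))

/-- `ℓ_{i,σ} ⊂ H^{0,1}(B)` for `σ ∉ T_i` (the interface's `h01`). -/
theorem eigenLine_le_h01 (F : FaceSetting K) {i : Fin 4} {σ : K →+* ℂ} (h : σ ∉ F.T i) :
    eigenLine K i σ ≤ h01 F :=
  le_iSup_of_le i (le_iSup_of_le σ (le_iSup (fun _ : σ ∈ (F.T i)ᶜ => eigenLine K i σ) h))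

/-- A balanced face: the base embedding `τ₁` lies in exactly two of the four CM types (p1's `IsWeilFace`). -/
theorem exists_pair_of_face (F : FaceSetting K) (σ : K →+* ℂ) :
    ∃ a b : Fin 4, a < b ∧ ∀ i, σ ∈ F.T i ↔ i = a ∨ i = b := by
  classical
  have hcard : (Finset.univ.filter fun i : Fin 4 => σ ∈ F.T i).card = 2 := by
    have := F.face.2 σ
    rw [Nat.card_eq_fintype_card, Fintype.card_subtype] at this
    exact this
  obtain ⟨a, b, hab, hset⟩ := Finset.card_eq_two.1 hcard
  have hmem : ∀ i : Fin 4, σ ∈ F.T i ↔ i = a ∨ i = b := by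
    intro i
    have := Finset.ext_iff.1 hset i
    simpa [Finset.mem_filter, Finset.mem_insert, Finset.mem_singleton] using this
  rcases lt_or_gt_of_ne hab with h | h
  · exact ⟨a, b, h, hmem⟩
  · exact ⟨b, a, h, fun i => (hmem i).trans or_comm⟩

variable {F : FaceSetting K} {P : NDatum F} {LG : Type} [NormedAddCommGroup LG]
  [InnerProductSpace ℂ LG] {FA FB : P.Choice → LG}

/-- THEOREM ID(i)+(iv) in kernel (TIER5 route/T5-ID-p2.md): for an admissible choice `c`, the quadruple
period is `± c_K` times the Petersson pairing `⟪F_B c, F_A c⟫ = ⟨F_A, F_B⟩_{L²([G])}` — the sign is the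
sign of the permutation sorting the four vertices into the two with `τ₁ ∈ T_i` (the `(1,0)`-classes)
followed by the two with `τ₁ ∉ T_i`. Consumes the four displays of `T6N1Hyp` by name. -/
theorem I_eq (d : N1Datum F P LG FA FB) (hH : Hyp.Voisin2002_7_3_2 d) (hL : Hyp.Voisin2002_Lemma5_4_petersson d)
    (hA : Hyp.Liu2021_Prop4_13_vertexLiftA d) (hB : Hyp.Liu2021_Prop4_13_vertexLiftB d) (c : P.Choice)
    (hc : P.AdmChoice c) :
    P.I P.τ₁ c = (d.cK : ℂ) * d.pairing c ∨ P.I P.τ₁ c = -((d.cK : ℂ) * d.pairing c) := by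
  classical
  -- the four pulled-back generators
  set v : Fin 4 → (P.shadow c).HS :=
    fun i => (P.shadow c).pull (ExteriorAlgebra.ι ℂ (P.e P.τ₁ i)) with hv
  have hswap : ∀ i j, v i * v j = -(v j * v i) := by
    intro i j
    simp only [hv]
    rw [← map_mul (P.shadow c).pull, ← map_mul (P.shadow c).pull, ← map_neg (P.shadow c).pull]
    congr 1
    exact eq_neg_of_add_eq_zero_left (ExteriorAlgebra.ι_add_mul_swap _ _)
  have hI : P.I P.τ₁ c = (P.shadow c).intS (v 0 * v 1 * v 2 * v 3) := by
    simp only [NDatum.I, hv, map_mul]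
  -- the sorting of the vertices
  obtain ⟨a, b, hab, hmem⟩ := exists_pair_of_face F P.τ₁
  obtain ⟨k, l, hkl, hka, hkb, hla, hlb, hprod⟩ := prod_eq_pair v hswap a b hab
  have ha : P.τ₁ ∈ F.T a := (hmem a).2 (Or.inl rfl)
  have hb : P.τ₁ ∈ F.T b := (hmem b).2 (Or.inr rfl)
  have hk : P.τ₁ ∉ F.T k := fun h => by rcases (hmem k).1 h with h | h <;> [exact hka h; exact hkb h]
  have hl : P.τ₁ ∉ F.T l := fun h => by rcases (hmem l).1 h with h | h <;> [exact hla h; exact hlb h]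
  -- the two (2,0)-classes
  have hva : v a ∈ d.H10 c := (hH c).1 _ (eigenLine_le_h10 F ha (P.e_mem _ _))
  have hvb : v b ∈ d.H10 c := (hH c).1 _ (eigenLine_le_h10 F hb (P.e_mem _ _))
  have hvk : d.conj c (v k) ∈ d.H10 c := (hH c).2 _ (eigenLine_le_h01 F hk (P.e_mem _ _))
  have hvl : d.conj c (v l) ∈ d.H10 c := (hH c).2 _ (eigenLine_le_h01 F hl (P.e_mem _ _))
  have hωA : v a * v b ∈ d.H20 c := Submodule.mul_mem_mul hva hvb
  have hωB : d.conj c (v k) * d.conj c (v l) ∈ d.H20 c := Submodule.mul_mem_mul hvk hvl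
  have hkl' : v k * v l = d.conj c (d.conj c (v k) * d.conj c (v l)) := by
    rw [map_mul, d.conj_conj, d.conj_conj]
  -- the identification
  have key : (P.shadow c).intS (v a * v b * (v k * v l)) = (d.cK : ℂ) * d.pairing c := by
    rw [hkl', hL c hc _ hωA _ hωB, hA c hc a b hab ha hb, hB c hc k l hkl hk hl]
    rfl
  rcases hprod with h | h
  · exact Or.inl (by rw [hI, h, key])
  · exact Or.inr (by rw [hI, h, map_neg, key])

/-- SUB-STEP N1 (TARGET-T6 §9.3, the field statement `N1` of `T5Assembly.AssemblyCore` with `S := K →+* ℂ`,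
`Datum := Unit`, `Choice := P.Choice`, `K := ℂ`): for every admissible choice `c`, a non-zero Petersson
pairing `⟪F_B c, F_A c⟫_ℂ` gives a non-zero quadruple period `I_{τ₁}(D_c, c)`. Through
`T5Assembly.N1_of_const` with `κ c = ± c_K` (Theorem ID(iv)); consumes the displays of `T6N1Hyp` by name. -/
theorem N1_main (d : N1Datum F P LG FA FB) (hH : Hyp.Voisin2002_7_3_2 d)
    (hL : Hyp.Voisin2002_Lemma5_4_petersson d) (hA : Hyp.Liu2021_Prop4_13_vertexLiftA d) (hB : Hyp.Liu2021_Prop4_13_vertexLiftB d) :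
    ∀ c : P.Choice, P.AdmChoice c → d.pairing c ≠ 0 → P.I P.τ₁ c ≠ 0 := by
  classical
  have hcK : (d.cK : ℂ) ≠ 0 := by exact_mod_cast d.cK_pos.ne'
  refine T5Assembly.N1_of_const (fun _ : Unit => P.AdmChoice) (fun σ _ c => P.I σ c)
    (fun _ c => d.pairing c) P.τ₁ ()
    (fun c => if P.I P.τ₁ c = (d.cK : ℂ) * d.pairing c then (d.cK : ℂ) else -(d.cK : ℂ)) ?_ ?_
  · intro c _
    split_ifs
    · exact hcK
    · exact neg_ne_zero.2 hcK
  · intro c hc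
    split_ifs with h
    · exact h
    · rcases I_eq d hH hL hA hB c hc with h' | h'
      · exact absurd h' h
      · rw [h', neg_mul]

end Summit.Ventures.HodgeRepro2.T6.N1Main
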